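import Summits.QuantumAdvantage.AdviceFreeQNC0.AffBells35PolyLossOfIFM
import HarnessLib

/-!
# AffBells36 — SIMULATION form of the last box (planner qa-qnc0-p1 g36, ROUND-35 §2)

The endgame of (NP₁) `AffBells26.AffBellsPolyLoss3` so far ran through WIDE-ROW ELIMINATION (exp35/WREL35.lean:
fire wide rows to CONSTANTS until every row is polylog-narrow, then `AffBells34.affCoverPolylogHard`).  The tree's
cover theorem is much more permissive than that target:

* it is about TABLES `g_k` (arbitrary Boolean functions), not affine rows;
* every table may read a COMMON set `W` of up to `N/3` positions ARBITRARILY plus `(log₂ N)^C` further positions;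
* only WINS matter, so a replacement strategy need only win where the original wins (ONE-SIDED defect), and
  by the target formula only the parity `#{active k : z_k = 1}` of the answer enters the relation.

`JuntaSimulation` packages exactly what has to be CONSTRUCTED: for a near-perfect affine strategy, tables of that
shape losing at most a `1/N` fraction of the original wins.  `polyLoss_of_juntaSimulation : JuntaSimulation →
AffBellsPolyLoss3` is proved here (cover hardness + a union bound; no iteration, no potential).  Every elimination
scheme of ROUND-34 (firing to constants, generalised residues, component firing) and the new REBASING / COLUMN
DELETION moves of ROUND-35 are special simulations.

WHAT THIS IS NOT: `JuntaSimulation` is OPEN (it is the last box, re-typed); crux 22907 untouched.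
Ported to the tree verbatim by the prover seat qn-prover-3 g20 (ask of planner qa-qnc0-p1 g36, INBOX 11:15Z; `HOME/qa-qnc0-p1/exp36/Sim36.lean`,
farm rc 0 / 0 sorry); serves stmt-QuantumAdvantage-22907 (untagged: the gate refuses `--supports` across sub-problems).
-/

noncomputable section

open Classical

namespace Summit.QuantumAdvantage.AdviceFreeQNC0.AffBells36

open Finset Literature.Computability.QuantumComplexity Literature.Computability.QuantumComplexity.RingHLF
open AffBells22 AffBells23 AffBells26 AffBells29

variable {N : ℕ}

/-- the ONE-SIDED DEFECT of a table strategy `g` against the affine strategy `(β, c)`: odd inputs won by `(β,c)` and lost by `g`. -/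
def simDefect (β : Fin N → Fin N → ZMod 3) (c : Fin N → ZMod 3) (g : Fin N → (Fin N → Bool) → Bool) : ℕ :=
  (univ.filter fun x : Fin N → Bool => OddZeros x ∧ Rel x (affBell β c x) ∧ ¬ Rel x (fun k => g k x)).card

/-- **THE LAST BOX, SIMULATION FORM.**  Some `e, C`: for `N ≥ n₀`, every affine MOD₃ bell strategy winning MORE than
`(1 − N^{−e})·2^{N−1}` odd inputs is simulated — up to a one-sided defect of at most `2^{N−1}/N` inputs — by tables `g_k`
reading `T_k` with `|T_k \ W| ≤ (log₂ N)^C` for one common set `W`, `3|W| ≤ N`. -/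
def JuntaSimulation : Prop :=
  ∃ e C n₀ : ℕ, ∀ N ≥ n₀, ∀ (β : Fin N → Fin N → ZMod 3) (c : Fin N → ZMod 3),
    (1 - 1 / (N : ℝ) ^ e) * (2 : ℝ) ^ (N - 1) < (affWinCard β c : ℝ) →
      ∃ (W : Finset (Fin N)) (T : Fin N → Finset (Fin N)) (g : Fin N → (Fin N → Bool) → Bool),
        3 * W.card ≤ N ∧ (∀ k, (T k \ W).card ≤ (Nat.log 2 N) ^ C) ∧ (∀ k, ReadsOnly (T k) (g k)) ∧
          simDefect β c g * N ≤ 2 ^ (N - 1)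

/-- union bound: the affine strategy wins at most where the simulating tables win, plus the defect. -/
theorem affWinCard_le_winCount_add_simDefect (β : Fin N → Fin N → ZMod 3) (c : Fin N → ZMod 3)
    (g : Fin N → (Fin N → Bool) → Bool) :
    affWinCard β c ≤ winCount (fun x k => g k x) + simDefect β c g := by
  unfold affWinCard winCount simDefect
  rw [← card_union_of_disjoint]
  · apply card_le_card
    intro x hx
    rw [mem_filter] at hx
    rw [mem_union, mem_filter, mem_filter]
    by_cases hg : Rel x (fun k => g k x)
    · exact Or.inl ⟨mem_univ _, hx.2.1, hg⟩
    · exact Or.inr ⟨mem_univ _, hx.2.1, hx.2.2, hg⟩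
  · rw [disjoint_filter]
    intro x _ h1 h2
    exact h2.2.2 h1.2

/-- **`JuntaSimulation → (NP₁)`.** -/
theorem polyLoss_of_juntaSimulation (h : JuntaSimulation) : AffBellsPolyLoss3 := by
  obtain ⟨e, C, n₀, hsim⟩ := h
  obtain ⟨θ, hθ, hcov⟩ := AffBells34.coverPolylogHard
  obtain ⟨n₁, hn₁⟩ := hcov C
  obtain ⟨M, hM⟩ := exists_nat_gt (2 / (1 - θ))
  refine ⟨e + 1, max (max n₀ n₁) (max M 2), fun N hN β c => ?_⟩
  have hNn₀ : n₀ ≤ N := le_trans (le_trans (le_max_left _ _) (le_max_left _ _)) hN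
  have hNn₁ : n₁ ≤ N := le_trans (le_trans (le_max_right _ _) (le_max_left _ _)) hN
  have hNM : M ≤ N := le_trans (le_trans (le_max_left _ _) (le_max_right _ _)) hN
  have hN2 : 2 ≤ N := le_trans (le_trans (le_max_right _ _) (le_max_right _ _)) hN
  have h1θ : 0 < 1 - θ := by linarith
  have hMpos : (0 : ℝ) < M := lt_trans (by positivity) hM
  have hMR : (M : ℝ) ≤ N := by exact_mod_cast hNM
  have hNpos : (0 : ℝ) < N := lt_of_lt_of_le hMpos hMR
  have hN1 : (1 : ℝ) ≤ N := by exact_mod_cast (show 1 ≤ N by omega)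
  have h2pos : (0 : ℝ) < (2 : ℝ) ^ (N - 1) := pow_pos (by norm_num) _
  by_contra hW
  rw [not_le] at hW
  -- near-perfect at level `e`
  have hmono : (1 - 1 / (N : ℝ) ^ e) * (2 : ℝ) ^ (N - 1) ≤ (1 - 1 / (N : ℝ) ^ (e + 1)) * (2 : ℝ) ^ (N - 1) := by
    apply mul_le_mul_of_nonneg_right _ h2pos.le
    have : 1 / (N : ℝ) ^ (e + 1) ≤ 1 / (N : ℝ) ^ e :=
      div_le_div_of_nonneg_left zero_le_one (by positivity) (pow_le_pow_right₀ hN1 (Nat.le_succ e))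
    linarith
  obtain ⟨W, T, g, hW3, hT, hread, hdef⟩ := hsim N hNn₀ β c (lt_of_le_of_lt hmono hW)
  have hcovN := hn₁ N hNn₁ W T g hW3 hT hread
  have hub := affWinCard_le_winCount_add_simDefect β c g
  have hubR : (affWinCard β c : ℝ) ≤ (winCount (fun x k => g k x) : ℝ) + (simDefect β c g : ℝ) := by
    exact_mod_cast hub
  have hdefR : (simDefect β c g : ℝ) * N ≤ (2 : ℝ) ^ (N - 1) := by exact_mod_cast hdef
  have hdefR' : (simDefect β c g : ℝ) ≤ (2 : ℝ) ^ (N - 1) / N := by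
    rw [le_div_iff₀ hNpos]; exact hdefR
  -- `1/N^(e+1) + 1/N ≤ 2/N ≤ 1 - θ`
  have hsmall : 1 / (N : ℝ) ^ (e + 1) + 1 / (N : ℝ) ≤ 1 - θ := by
    have ha : 1 / (N : ℝ) ^ (e + 1) ≤ 1 / (N : ℝ) := by
      apply div_le_div_of_nonneg_left zero_le_one hNpos
      calc (N : ℝ) = (N : ℝ) ^ 1 := (pow_one _).symm
        _ ≤ (N : ℝ) ^ (e + 1) := pow_le_pow_right₀ hN1 (by omega)
    have hb : 2 / (N : ℝ) ≤ 1 - θ := by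
      calc 2 / (N : ℝ) ≤ 2 / (M : ℝ) := div_le_div_of_nonneg_left (by norm_num) hMpos hMR
        _ ≤ 1 - θ := by
            rw [div_le_iff₀ hMpos]
            have := (div_lt_iff₀ h1θ).1 hM
            linarith
    have : 1 / (N : ℝ) ^ (e + 1) + 1 / (N : ℝ) ≤ 2 / (N : ℝ) := by
      rw [show (2 : ℝ) / N = 1 / N + 1 / N by ring]; linarith
    linarith
  -- combine
  have key : (1 - 1 / (N : ℝ) ^ (e + 1)) * (2 : ℝ) ^ (N - 1) < θ * (2 : ℝ) ^ (N - 1) + (2 : ℝ) ^ (N - 1) / N := by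
    linarith
  have key' : (1 - 1 / (N : ℝ) ^ (e + 1)) * (2 : ℝ) ^ (N - 1) < (θ + 1 / N) * (2 : ℝ) ^ (N - 1) := by
    have : (θ + 1 / N) * (2 : ℝ) ^ (N - 1) = θ * (2 : ℝ) ^ (N - 1) + (2 : ℝ) ^ (N - 1) / N := by ring
    rw [this]; exact key
  have hcoef : 1 - 1 / (N : ℝ) ^ (e + 1) < θ + 1 / N := lt_of_mul_lt_mul_right key' h2pos.le
  linarith

/-- **W-ABSORPTION.**  If the supports of all `(log₂ N)^C`-wide rows together cover at most `N/3` positions, the strategy already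
loses a constant fraction (`affCoverPolylogHard` with `W :=` that union): the elimination / simulation of wide rows is needed only
while the wide rows cover more than a third of the cycle («macroscopic wires»). -/
def wideUnion (C : ℕ) (β : Fin N → Fin N → ZMod 3) : Finset (Fin N) :=
  (univ.filter fun b : Fin N => (Nat.log 2 N) ^ C < (rowSupp β b).card).biUnion (rowSupp β)

/-- `loss_of_wideUnion_small` (planner qa-qnc0-p1 g36, exp36/Sim36.lean). -/
theorem loss_of_wideUnion_small : ∃ θ : ℝ, θ < 1 ∧ ∀ C : ℕ, ∃ n₀ : ℕ, ∀ N ≥ n₀,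
    ∀ (β : Fin N → Fin N → ZMod 3) (c : Fin N → ZMod 3), 3 * (wideUnion C β).card ≤ N →
      (affWinCard β c : ℝ) ≤ θ * (2 : ℝ) ^ (N - 1) := by
  obtain ⟨θ, hθ, hcov⟩ := AffBells34.affCoverPolylogHard
  refine ⟨θ, hθ, fun C => ?_⟩
  obtain ⟨n₀, hn₀⟩ := hcov C
  refine ⟨n₀, fun N hN β c hW => hn₀ N hN β c (wideUnion C β) hW fun b => ?_⟩
  by_cases hb : (Nat.log 2 N) ^ C < (rowSupp β b).card
  · have hsub : rowSupp β b ⊆ wideUnion C β := by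
      intro i hi
      exact mem_biUnion.2 ⟨b, mem_filter.2 ⟨mem_univ _, hb⟩, hi⟩
    rw [sdiff_eq_empty_iff_subset.2 hsub, card_empty]
    exact Nat.zero_le _
  · exact le_trans (card_le_card sdiff_subset) (not_lt.1 hb)

end Summit.QuantumAdvantage.AdviceFreeQNC0.AffBells36
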